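import Summits.BirchSwinnertonDyer.BirchSwinnertonDyer.Theses.PlecticLegs
import Literature.NumberTheory.EllipticCurves.SelmerCorankHolds
import Literature.NumberTheory.EllipticCurves.StrictSelmerRankOne
import Literature.NumberTheory.DiophantineGeometry.LocalReduction
import Literature.Barriers.BirchSwinnertonDyer.PlecticDeterminantOverQ
import Summits.BirchSwinnertonDyer.BirchSwinnertonDyer.Theorems.PlecticLegsPlecticRankUBStubReceptacleCollapse
import HarnessLib

/-!
# Line `Sketch` (card `exceptional-legs-plectic-cap`) — skeleton v2 for crux `PlecticRankUB`
# (stmt-BirchSwinnertonDyer-17519, route `PlecticLegs`, crux #3)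

Crux (verbatim, `Theses/PlecticLegs.lean`):
`∀ F [NumberField F] [IsTotallyReal F] (V : WeierstrassCurve F) [V.IsElliptic],
  2 ≤ [F:ℚ] → V.analyticRank = [F:ℚ] → V.mordellWeilRank ≤ [F:ℚ]`.

## Composition (lead `prover-line-stmt-BirchSwinnertonDyer-17519-0`, cycle 1, 2026-08-17; v2 = v1 with S3, S4 LANDED)

The line (Fornea's plectic Heegner classes with `d - 1` multiplicative `p`-adic legs, capped by a
bipartite Euler system over `F`; ignition split into identities (I1) `κ = det w`, (I2) archimedean
plectic Gross–Zagier, (I3) injectivity of `det`, free at `d = 2`) lives on the PLECTIC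
MULTIPLICATIVE SECTOR: some rational prime `p` and a set `S` of at least `d - 1` primes of `F`
above `p` at which `V` has multiplicative reduction. The skeleton cuts the crux along that sector:

* **S1 `stub_onSector_selmerCap`** — the line's engine OUTPUT on the sector, at Selmer level (what a
  Kolyvagin-type cap of a non-zero Selmer class delivers): `∃ p, corank_{ℤ_p} Sel_{p^∞}(V/F) ≤ d`.
  It is `CapShapeF Q ∧ IgnitionShapeF Q` of the card FUSED, because the only `Q` ("an admissible
  plectic Heegner class of `V` is Selmer and non-zero") is not nameable over the tree today
  (definition request D1 of the card: `PlecticHeegnerDatum F V p`, Fornea arXiv:2603.28327 Thms 1–4);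
  with any nameable `Q` the two shapes collapse to this statement. OPEN (Fornea Conj. 1.9/1.10 +
  the `F`-extension of Fornea–Gehrmann 2023 Thm 1.1). Held by the lead.
* **S2 `stub_offSector`** — the honest complement: the crux OFF the sector (integral `j`, or fewer
  than `d - 1` multiplicative primes above every `p`). The card's `UBOffSector`; no engine in print at
  any order `≥ 2` (STRATEGY-CENSUS §Transfer T1–T4). Crux-sized by the card's own LIMITS (a).
* **S3 `stub_strictSelmerInfinite`** (LANDED p147148, `PlecticLegsPlecticRankUBStubStrictSelmerInfinite`),
  **S4 `stub_receptacleCollapse`** (LANDED p146831, `PlecticLegsPlecticRankUBStubReceptacleCollapse`) — the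
  card's two DESIGN lemmas (no-go results; they do not feed the composition; S4's module is imported here, S3's is
  tree module `Summits.BirchSwinnertonDyer.BirchSwinnertonDyer.Theorems.PlecticLegsPlecticRankUBStubStrictSelmerInfinite`): S3 = on the base-change
  family every core-rank-`d` Kolyvagin system for the structure relaxed at `p` has `κ₁ = 0`
  (its dual, the strict Selmer group, is infinite as soon as `rank E(ℚ) ≥ 2`); S4 = Fornea's
  receptacle (`r - 1` local columns + one Kummer column) still collapses on `ℚ`-points for `r ≥ 3`
  (two columns through one line kill the localised determinant), so (I3) is FALSE on the family at
  `d ≥ 3` (`receptacleCollapse_of_stub`, derived below from S4).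

`PlecticRankUB_of : PlecticRankUB` concludes the crux BY NAME from S1 (through the PROVED Kummer
identity `selmerCorank_eq_mordellWeilRank_add_holds`: `rank ≤ corank` over any number field) and S2.
`stub_offSector_of_plecticRankUB` records that S2 is a literal restriction of the crux.
-/

set_option linter.dupNamespace false

namespace Summit.BirchSwinnertonDyer.BirchSwinnertonDyer.Theorems

open scoped Classical
open WeierstrassCurve IsDedekindDomain NumberField
open Summit.BirchSwinnertonDyer.BirchSwinnertonDyer.Theses.PlecticLegs (PlecticRankUB)
open Literature.NumberTheory.EllipticCurves Literature.Barriers.BirchSwinnertonDyer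

/-! ### Registered stubs -/

/-- Stub **S1** (on-sector Selmer cap; the line's `C⁺` output): for `V` elliptic over a totally real
`F` of degree `d ≥ 2` in the plectic regime `r_an(V/F) = d`, lying on the plectic multiplicative
sector (`∃ p` and `≥ d - 1` primes of `F` above `p` of multiplicative reduction), some `p^∞`-Selmer
corank is at most `d`. Intended engine: Fornea's plectic Heegner class with `d - 1` legs is Selmer
and non-zero (ignition, Fornea arXiv:2603.28327 Conj. 1.9/1.10 ⇐ (I1)+(I2)+(I3)) and a bipartite Euler
system over `F` caps the Selmer corank by `d` (the `F`-extension of Fornea–Gehrmann arXiv:2311.03100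
Thm 1.1). OPEN. [cite: arXiv:2603.28327, Conj. 1.10] -/
theorem stub_onSector_selmerCap :
    ∀ (F : Type) [Field F] [NumberField F] [NumberField.IsTotallyReal F] (V : WeierstrassCurve F)
      [V.IsElliptic], 2 ≤ Module.finrank ℚ F → V.analyticRank = Module.finrank ℚ F →
      (∃ p : ℕ, p.Prime ∧ ∃ S : Finset (HeightOneSpectrum (𝓞 F)),
          Module.finrank ℚ F ≤ S.card + 1 ∧
            ∀ v ∈ S, (p : 𝓞 F) ∈ v.asIdeal ∧ V.HasMultiplicativeReductionAt v) →
      ∃ p : ℕ, p.Prime ∧ V.selmerCorank p ≤ Module.finrank ℚ F := by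
  sorry

/-- Stub **S2** (off-sector complement; the card's `UBOffSector`): the crux for curves NOT on the
plectic multiplicative sector. No engine in print at any order `≥ 2`; crux-sized (card LIMITS (a),
STRATEGY-CENSUS §Transfer). [folklore] -/
theorem stub_offSector :
    ∀ (F : Type) [Field F] [NumberField F] [NumberField.IsTotallyReal F] (V : WeierstrassCurve F)
      [V.IsElliptic], 2 ≤ Module.finrank ℚ F → V.analyticRank = Module.finrank ℚ F →
      ¬ (∃ p : ℕ, p.Prime ∧ ∃ S : Finset (HeightOneSpectrum (𝓞 F)),
          Module.finrank ℚ F ≤ S.card + 1 ∧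
            ∀ v ∈ S, (p : 𝓞 F) ∈ v.asIdeal ∧ V.HasMultiplicativeReductionAt v) →
      V.mordellWeilRank ≤ Module.finrank ℚ F := by
  sorry

/-! ### Composition -/

/-- **Composition of line `Sketch` (skeleton v1).** On the plectic multiplicative sector, S1 gives a
prime `p` with `corank_{ℤ_p} Sel_{p^∞}(V/F) ≤ d`, and the proved Kummer identity
`corank Sel_{p^∞} = rank + corank Ш[p^∞]` (`selmerCorank_eq_mordellWeilRank_add_holds`, any number
field) gives `rank V(F) ≤ d`; off the sector S2 is the statement. Concludes `PlecticRankUB` BY NAME.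
[folklore] -/
theorem PlecticRankUB_of : PlecticRankUB := by
  intro F _ _ _ V _ hd hran
  by_cases hsec : ∃ p : ℕ, p.Prime ∧ ∃ S : Finset (HeightOneSpectrum (𝓞 F)),
      Module.finrank ℚ F ≤ S.card + 1 ∧
        ∀ v ∈ S, (p : 𝓞 F) ∈ v.asIdeal ∧ V.HasMultiplicativeReductionAt v
  · obtain ⟨p, hp, hcap⟩ := stub_onSector_selmerCap F V hd hran hsec
    haveI : Fact p.Prime := ⟨hp⟩
    have hk : V.selmerCorank p = V.mordellWeilRank + V.shaCorank p :=
      V.selmerCorank_eq_mordellWeilRank_add_holds p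
    omega
  · exact stub_offSector F V hd hran hsec

/-! ### Sanity: S2 is a literal restriction of the crux; the landed S4 gives the card's collapse statement -/

/-- **No stub on the Mordell–Weil side is stronger than the crux**: `PlecticRankUB → S2`. [folklore] -/
theorem stub_offSector_of_plecticRankUB (h : PlecticRankUB) :
    ∀ (F : Type) [Field F] [NumberField F] [NumberField.IsTotallyReal F] (V : WeierstrassCurve F)
      [V.IsElliptic], 2 ≤ Module.finrank ℚ F → V.analyticRank = Module.finrank ℚ F →
      ¬ (∃ p : ℕ, p.Prime ∧ ∃ S : Finset (HeightOneSpectrum (𝓞 F)),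
          Module.finrank ℚ F ≤ S.card + 1 ∧
            ∀ v ∈ S, (p : 𝓞 F) ∈ v.asIdeal ∧ V.HasMultiplicativeReductionAt v) →
      V.mordellWeilRank ≤ Module.finrank ℚ F :=
  fun F _ _ _ V _ hd hran _ => h F V hd hran

/-- **Fornea's receptacle collapses on `ℚ`-points for `r ≥ 3`** (the card's statement (2)): if the
`r - 1` local columns `ι j`, `j + 1 < r`, all factor through one line `L₀` (for `A` defined over
`ℚ`: `Â(ℚ_p) ⊗ ℚ_p`), then `locDeterminant ι = 0` — from the landed S4 (tree theorem `stub_receptacleCollapse`) with the two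
columns `0` and `1`.
[cite: ForneaGehrmann2023, Rem. 1.1] -/
theorem receptacleCollapse_of_stub (K : Type) [Field K] (r : ℕ) (V L₀ : Type) [AddCommGroup V]
    [Module K V] [AddCommGroup L₀] [Module K L₀] (L : Fin r → Type) [∀ j, AddCommGroup (L j)]
    [∀ j, Module K (L j)] (ι : ∀ j : Fin r, V →ₗ[K] L j) (κ : V →ₗ[K] L₀)
    (e : ∀ j : Fin r, L₀ →ₗ[K] L j) (hr : 3 ≤ r) (hL : Module.rank K L₀ ≤ 1)
    (hfac : ∀ j : Fin r, (j : ℕ) + 1 < r → ι j = (e j).comp κ) : locDeterminant ι = 0 :=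
  stub_receptacleCollapse K r V L₀ L ι κ ⟨0, by omega⟩ ⟨1, by omega⟩ (e _) (e _)
    (by simp [Fin.ext_iff]) hL (hfac _ (by simp; omega)) (hfac _ (by simp; omega))

end Summit.BirchSwinnertonDyer.BirchSwinnertonDyer.Theorems
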